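import Summits.ResolutionOfSingularities.ResolutionOfSingularities.Theses.SectionAscent
import Summits.ResolutionOfSingularities.ResolutionOfSingularities.Theorems.SectionAscentFibrewiseClosedPointsClosedPointsSuffice
import Summits.ResolutionOfSingularities.ResolutionOfSingularities.Theorems.SectionAscentFibrewiseClosedPointsLowDimPoint
import Summits.ResolutionOfSingularities.ResolutionOfSingularities.Theorems.SectionAscentFibrewiseClosedPointsCertificateRegular
import Summits.ResolutionOfSingularities.ResolutionOfSingularities.Theorems.SectionAscentFibrewiseClosedPointsCertificatesOnRegularBlowup
import Summits.ResolutionOfSingularities.ResolutionOfSingularities.Theorems.SectionAscentFibrewiseClosedPointsOneShotDimZero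
import Summits.ResolutionOfSingularities.ResolutionOfSingularities.Theorems.SectionAscentFibrewiseClosedPointsOneShotCurves
import Literature.AlgebraicGeometry.Resolution.RegularLocalRingsNormal
import HarnessLib

/-!
# Crux `FibrewiseClosedPoints` (stmt-ResolutionOfSingularities-15960) — birth skeleton (BC3), line `birth`

Route `ResolutionOfSingularities/SectionAscent` (STRENGTHEN lens), inductive step, second half:
`FibrewiseClosedPoints` = "for every prime `p` and every `d`: `OneShot p d → Almost p (d+1) →
OneShot p (d+1)`", where `OneShot p d` is strong one-shot resolution of integral affine varieties
of dimension `< d` over all fields of characteristic `p` (one blowing up `Bl_I(Spec A)`, regular,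
with `V(I) = Sing(Spec A)` exactly) and `Almost p d` asks for one NORMAL blowing up with
`V(I) ⊇ Sing` that is regular at every point not closed in its fibre.

## Standing of the crux as typed (read first)

Refuter route-review evidence `SectionAscent_Almost_trivial.md` (2026-08-16, on this item) shows
that the `let`-predicate `Almost` is inhabited unconditionally (a blowing up presenting the
normalisation, multiplied by a nonzero element of the Jacobian ideal: finite fibres make the
"not closed in its fibre" clause vacuous), so AS TYPED the crux is the whole inductive step
`OneShot p d → OneShot p (d+1)` of strong affine one-shot resolution (grounder g48-7 note). This
skeleton is honest about that: the `Almost` hypothesis is NOT used (it cannot carry weight), and the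
three stubs prove the step `OneShot p d → OneShot p (d+1)` itself (`step_of_parts`), along the
route's own two-layer plan for this crux ("BasePointCriterion → SimultaneousLift", route header
TWO-LAYER PLAN) with the STRENGTHEN-lens cost (isomorphism over `Reg`, i.e. exact support) split
off as a third named piece.

## The cut (three named pieces; `FibrewiseClosedPoints_of` proved from them)

LEAD RESHAPE (prover-line-stmt-ResolutionOfSingularities-15960-0, cycle 1, 2026-08-17): the first
piece below, the provable size-L criterion, is now registered as THREE stubs
(`stub_closedPointsSuffice`, `stub_lowDimPoint`, `stub_certificateRegular`, see `## The stubs`) whose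
sorry-free composition `closedPointCriterion_of_stubs : ClosedPointCriterion` replaces the former
single stub `stub_closedPointCriterion`; registered stubs are therefore FIVE:
`stub_closedPointsSuffice`, `stub_lowDimPoint`, `stub_certificateRegular`, `stub_weakSectionLift`,
`stub_supportSharpening`. WAVE 1 (2026-08-17) LANDED all three criterion stubs (`--supports`:
p147124, p148953, p155011 with helpers p149281/p149282/p149283/p152380), so `ClosedPointCriterion`
is kernel-closed (`closedPointCriterion_of_stubs`); WAVE 2 landed the calibration/instance stubs
`stub_certificatesOnRegularBlowup` (p159562, helpers p157982/p158519/p159194),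
`stub_oneShotDimZero` (p156410), `stub_oneShotCurves` (p157426, helper p156898) — see
`## Calibration of the open stubs`: the two remaining `sorry`s, `stub_weakSectionLift`
(⟺ `∀ p d, OneShot p d → WeakOneShot p (d+1)`, `weakSectionLift_iff`) and
`stub_supportSharpening` (weak ⇒ strong one-shot), are OPEN PROBLEMS IN PRINT (the latter already
for affine threefolds, CossartPiltant2019 p. 3), and the crux holds unconditionally for `d ≤ 1`
(`fibrewiseClosedPoints_of_le_one`). The mathematics of the cut is unchanged:


* `stub_closedPointCriterion` — **closed-point section criterion (PROVABLE, size L).** `Spec A`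
  integral affine of finite type over a field `K` of characteristic `p`, `I ≠ 0`, `Bl_I(Spec A)`
  normal. Suppose every CLOSED point `y` of `Bl_I` carries a SECTION CERTIFICATE
  (`HasSectionCertificate`): a degree `m ≥ 1` and finitely many `g_j ∈ I^m` such that (a) every
  section `g_j t^m` of `𝒪(m)` vanishes at `y` (`g_j t^m ∈ 𝔭_y`, the homogeneous prime of `y` in the
  Rees algebra), (b) `y` is an ISOLATED base point among its generizations (every proper
  generization `z ⤳ y`, `z ≠ y`, misses some `g_j t^m` — for `z` the generic point this says some
  `g_j ≠ 0`), and (c) the blowing up along `I` of the GENERIC MEMBER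
  `H_g = Spec((K(t) ⊗_K A)/(Σ t_j ⊗ g_j))` of the sub-system — a `K(t)`-scheme of dimension
  `< dim A` — is regular. Then `Bl_I(Spec A)` is regular. Proof in print-sized steps: closed points
  suffice (finite type over a field ⇒ J-2, the non-regular locus is closed and, if nonempty,
  contains a closed point); a closed `y` with `dim 𝒪_y ≤ 1` is regular by normality (R₁); for
  `dim 𝒪_y ≥ 2` the unique point `P` of `Bl_I ⊗_K K(t)` above `y` (`κ(y)/K` finite ⇒
  `κ(y) ⊗_K K(t) = κ(y)(t)` a field) lies on `V(ℓ')`, `ℓ' = Σ t_j (g_j/s^m) ∈ 𝔪_P`; by (b) no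
  component of the exceptional divisor through `P` lies in `V(ℓ')` and by normality (S₂) `V(ℓ')`
  has no embedded component, so `V(ℓ') =` strict transform of `H_g` `= Bl_{I𝒪_{H_g}}(H_g)`
  scheme-theoretically near `P` (Stacks 080E); regularity of the latter (c) gives `𝒪_P/(ℓ')`
  regular ⇒ `𝒪_P` regular (EGA IV 0.17.1.7; tree `IsRegularLocalRing.of_quotient_span_singleton`)
  ⇒ `𝒪_y` regular by faithfully flat descent along `𝒪_y → 𝒪_P` (Matsumura 23.7; tree
  RegularLocalRingsFlatDescent). [difficulty: L — needs base change / strict-transform API for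
  `affineBlowup`, openness of the regular locus, normal ⇒ R₁/S₂]
* `stub_weakSectionLift` — **weak simultaneous section lift (OPEN — the hardest stub; the
  route's `SimultaneousLift`).** If `OneShot p d` holds, then every integral affine `Spec A` of
  finite type over a field `K` of characteristic `p` with `dim A < d+1` has an ideal `I ≠ 0` with
  `Bl_I` NORMAL such that every closed point of `Bl_I` carries a section certificate. Why plausible:
  it is implied by WEAK one-shot resolution at level `d+1` (given `Bl_I` regular, the generators of
  the degree-`m` part of `𝔭_y`, `m ≫ 0`, are a certificate: base locus `{y}`, generic member's
  strict transform regular off `y` by incidence Bertini on a regular scheme and at `P` because some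
  `g_j/s^m ∉ 𝔪_y²`), hence by the target `OneShotAffine`; it is NOT the crux reworded: it asks only
  for an `I` whose induced ideals `I·𝒪_{H_g}` resolve the `d`-DIMENSIONAL generic sections `H_g`
  (to which the hypothesis `OneShot p d` applies over the field `K(t)`), never for regularity of a
  `(d+1)`-fold, and it does not ask for exact support. Why it might fail: the resolving ideals of
  the sections `H_g` given by `OneShot p d` live over `K(t)` and may admit no common `t`-constant
  lift (route header: first open instance `d+1 = 4`, `z^p + F` fourfold germs); a closed singular
  point recurring on every candidate `Bl_I` ("vertical kangaroo") kills it. [difficulty: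
  open-problem]
* `stub_supportSharpening` — **strong from weak one-shot resolution (OPEN, size L/open; the
  STRENGTHEN-lens cost made a named statement).** An integral affine variety over a field of
  characteristic `p` that admits SOME nonzero ideal with regular blowing up admits one whose
  blowing up is regular AND whose zero set is exactly the non-regular locus (an isomorphism over
  `Reg`). Why plausible: implied by strong projective resolution of `Spec A` (a projective
  birational `X̃ → Spec A`, iso over `Reg`, is `Bl_{I'}` for an `I'` cosupported off `Reg`,
  Hartshorne II.7.17 + Ex. II.7.11(c), and then `V(I') = Sing` exactly), true in dimension `≤ 3`
  (CossartPiltant2019 Thm 1.1 (i)(ii) + Liu2002 8.1.24) and in characteristic `0`; genuinely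
  different from the crux (it is dimension-free and starts from a regular model). Why it might
  fail: a weak one-shot model may modify regular points of `V(I)` essentially — undoing that over
  `Reg ∩ V(I)` while keeping properness over `Sing` is a patching problem with no known mechanism in
  dimension `≥ 4`. [difficulty: open-problem (known in dim ≤ 3)]

Composition (`step_of_parts : ClosedPointCriterion → WeakSectionLift → SupportSharpening →
∀ p, p.Prime → ∀ d, OneShot p d → OneShot p (d+1)`, then `FibrewiseClosedPoints_of_parts` discards
the idle `Almost` hypothesis; both sorry-free; the skeleton theorem `FibrewiseClosedPoints_of :
FibrewiseClosedPoints` applies them to the three stubs): given `OneShot p d` and `Spec A` of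
dimension `< d+1`, the lift gives `I ≠ 0` with `Bl_I` normal and certificates at all closed
points; the criterion makes `Bl_I` regular; sharpening trades `I` for `I'` with `Bl_{I'}` regular
and `V(I') = Sing(Spec A)` exactly — which is `OneShot p (d+1)` at `(K, A)`.

Disproof used: no `Cruxes/FibrewiseClosedPoints/Disproof.lean` exists (crux dir empty at
2026-08-17T02:30Z, `ledger crux ls`); the only negative knowledge on the item is the refuter's
`Almost`-triviality note, honoured above (no stub consumes `Almost`; no stub is an instance of it).
`ledger negatives --problem ResolutionOfSingularities` (2026-08-17): 0 refuted statements on the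
summit, so no stub restates a refuted statement.

BC3 audit (2026-08-17, details in `Lines/birth.md`): `lean check` rc 0, errors [], sorries = 3 =
the three `stub_*` (declaration lines of `stub_closedPointCriterion`, `stub_weakSectionLift`,
`stub_supportSharpening`), zero `sorry` elsewhere; `#print axioms FibrewiseClosedPoints_of_parts` =
[propext, Classical.choice, Quot.sound]. Probes (`bc/birth_probe_<Stub>.lean`, stub statement
copied verbatim as `def <Stub> : Prop`, tactic `first | exact? | simpa [<Stub>] | (unfold <Stub>;
simpa) | aesop`, `maxHeartbeats 400000`): `Stub → FibrewiseClosedPoints` and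
`Stub → ResolutionOfSingularities` FAIL (rc 1, unsolved goals, aesop exhaustive search failed) for
all three stubs — 6/6; the deeper variants with the crux, `OneShot`, `Almost`, `ResolutionInChar`
and the stub unfolded first (`bc/birth_probe_deep.lean`, `aesop`) also fail 6/6.
-/

-- single-problem summit: the doubled namespace component `ResolutionOfSingularities` is forced
set_option linter.dupNamespace false

noncomputable section

open AlgebraicGeometry TopologicalSpace
open Literature.AlgebraicGeometry.Resolution
open Summit.ResolutionOfSingularities.ResolutionOfSingularities.Theses.SectionAscent
open scoped TensorProduct BigOperators Polynomial

namespace Summit.ResolutionOfSingularities.ResolutionOfSingularities.Cruxes.FibrewiseClosedPoints.Lines.Birth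

/-! ## The route's `let`-predicates, as named propositions (bodies verbatim) -/

/-- `OneShot p d` — STRONG ONE-SHOT AFFINE RESOLUTION below dimension `d` in characteristic `p`
(verbatim the `let OneShot` of the route file): every integral affine `Spec A` of finite type over
a field `K` of characteristic `p` with `dim A < d` has an ideal `I ≠ 0` with `Bl_I(Spec A)` regular
and `V(I) = Sing(Spec A)` exactly. [cite: CossartPiltant2019, Thm. 1.1 (dim ≤ 3)] -/
def OneShot (p d : ℕ) : Prop :=
  ∀ (K : Type) [Field K] [CharP K p] (A : Type) [CommRing A] [IsDomain A] [Algebra K A]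
    [Algebra.FiniteType K A], ringKrullDim A < (d : WithBot ℕ∞) → ∃ I : Ideal A, I ≠ ⊥ ∧
      Literature.AlgebraicGeometry.Resolution.Scheme.IsRegular
        (Literature.AlgebraicGeometry.Resolution.affineBlowup I) ∧
      ∀ 𝔭 : PrimeSpectrum A, I ≤ 𝔭.asIdeal ↔ ¬ IsRegularLocalRing (Localization.AtPrime 𝔭.asIdeal)

/-- `Almost p d` — the route's intermediate (verbatim the `let Almost` of the route file): one
normal blowing up with `V(I) ⊇ Sing` that is regular at every point not closed in its fibre.
(Inhabited unconditionally — refuter evidence `SectionAscent_Almost_trivial.md`; kept only to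
state the crux.) [folklore] -/
def Almost (p d : ℕ) : Prop :=
  ∀ (K : Type) [Field K] [CharP K p] (A : Type) [CommRing A] [IsDomain A] [Algebra K A]
    [Algebra.FiniteType K A], ringKrullDim A < (d : WithBot ℕ∞) → ∃ I : Ideal A, I ≠ ⊥ ∧
      (∀ 𝔭 : PrimeSpectrum A, ¬ I ≤ 𝔭.asIdeal → IsRegularLocalRing (Localization.AtPrime 𝔭.asIdeal)) ∧
      (∀ y : Literature.AlgebraicGeometry.Resolution.affineBlowup I,
        IsIntegrallyClosed ((Literature.AlgebraicGeometry.Resolution.affineBlowup I).presheaf.stalk y)) ∧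
      ∀ y : Literature.AlgebraicGeometry.Resolution.affineBlowup I,
        (∃ z : Literature.AlgebraicGeometry.Resolution.affineBlowup I, z ≠ y ∧ y ⤳ z ∧
          (Literature.AlgebraicGeometry.Resolution.affineBlowup.π I).base z =
            (Literature.AlgebraicGeometry.Resolution.affineBlowup.π I).base y) →
        IsRegularLocalRing ((Literature.AlgebraicGeometry.Resolution.affineBlowup I).presheaf.stalk y)

/-- The crux unfolds to `∀ p, p.Prime → ∀ d, OneShot p d → Almost p (d+1) → OneShot p (d+1)`
(ζ/δ-reduction of the route's `let`s). [folklore] -/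
theorem fibrewiseClosedPoints_iff :
    FibrewiseClosedPoints ↔ ∀ p : ℕ, p.Prime → ∀ d : ℕ, OneShot p d → Almost p (d + 1) → OneShot p (d + 1) :=
  Iff.rfl

/-! ## Generic members of sub-linear-systems of `I^m` and section certificates -/

/-- **The blowing up along `I` of the generic member of a sub-system is regular.** For a finite
family `g : Fin s → A` (of elements of some `I^m`), let `K(t) = Frac K[t_1, …, t_s]`,
`ℓ = Σ t_j ⊗ g_j ∈ K(t) ⊗_K A` the GENERIC MEMBER of the `K`-linear system spanned by the `g_j`,
`H_g = Spec((K(t) ⊗_K A)/(ℓ))` and `φ : A → 𝒪(H_g)`; the proposition is that `Bl_{I·𝒪(H_g)}(H_g)`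
(= the strict transform of `H_g` in `Bl_I ⊗_K K(t)`) is a regular scheme. Same typing as the
route's support item `SectionCriterion`. [cite: HunekeSwanson2006, Def. 8.4.1 and §8.5 (generic
elements over `R(t)`)] -/
def GenericSectionBlowupRegular (K : Type) [Field K] (A : Type) [CommRing A] [Algebra K A]
    (I : Ideal A) (s : ℕ) (g : Fin s → A) : Prop :=
  let Ks := FractionRing (MvPolynomial (Fin s) K)
  let ℓ : TensorProduct K Ks A :=
    ∑ j : Fin s, (algebraMap (MvPolynomial (Fin s) K) Ks (MvPolynomial.X j)) ⊗ₜ[K] g j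
  let φ : A →+* (TensorProduct K Ks A ⧸ Ideal.span {ℓ}) :=
    (Ideal.Quotient.mk (Ideal.span {ℓ})).comp
      (Algebra.TensorProduct.includeRight (R := K) (A := Ks) (B := A)).toRingHom
  Literature.AlgebraicGeometry.Resolution.Scheme.IsRegular
    (Literature.AlgebraicGeometry.Resolution.affineBlowup (I.map φ))

/-- **Section certificate at a point `y` of `Bl_I(Spec A)`**: a degree `m ≥ 1` and finitely many
`g_j ∈ I^m` such that (a) each section `g_j t^m` of `𝒪(m)` vanishes at `y` (lies in the
homogeneous prime `𝔭_y ⊂ A[It]`), (b) `y` is an isolated base point among its generizations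
(every `z ⤳ y`, `z ≠ y`, misses some `g_j t^m`; for the generic point: some `g_j ≠ 0`), and (c) the
blowing up along `I` of the generic member of the sub-system is regular. The κ(w)-kernel
sub-systems of the route header, in typed form. [folklore] -/
def HasSectionCertificate (K : Type) [Field K] (A : Type) [CommRing A] [Algebra K A]
    (I : Ideal A) (y : Literature.AlgebraicGeometry.Resolution.affineBlowup I) : Prop :=
  ∃ (m s : ℕ) (g : Fin s → A) (hg : ∀ j, g j ∈ I ^ m), 0 < m ∧
    (∀ j, (⟨Polynomial.monomial m (g j), reesAlgebra.monomial_mem.mpr (hg j)⟩ : reesAlgebra I) ∈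
      y.asHomogeneousIdeal) ∧
    (∀ z : Literature.AlgebraicGeometry.Resolution.affineBlowup I, z ⤳ y → z ≠ y →
      ∃ j, (⟨Polynomial.monomial m (g j), reesAlgebra.monomial_mem.mpr (hg j)⟩ : reesAlgebra I) ∉
        z.asHomogeneousIdeal) ∧
    GenericSectionBlowupRegular K A I s g

/-! ## The three stub statements as named propositions (used by the composition and the BC3 probes) -/

/-- Statement of `stub_closedPointCriterion`. [cite: EGAIV4, 0.17.1.7; Matsumura1987, Thm. 23.7;
StacksProject, Tag 080E] -/
def ClosedPointCriterion : Prop :=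
  ∀ (p : ℕ), p.Prime → ∀ (K : Type) [Field K] [CharP K p] (A : Type) [CommRing A] [IsDomain A]
    [Algebra K A] [Algebra.FiniteType K A] (I : Ideal A), I ≠ ⊥ →
    (∀ y : Literature.AlgebraicGeometry.Resolution.affineBlowup I,
      IsIntegrallyClosed ((Literature.AlgebraicGeometry.Resolution.affineBlowup I).presheaf.stalk y)) →
    (∀ y : Literature.AlgebraicGeometry.Resolution.affineBlowup I,
      IsClosed ({y} : Set (Literature.AlgebraicGeometry.Resolution.affineBlowup I)) →
        HasSectionCertificate K A I y) →
    Literature.AlgebraicGeometry.Resolution.Scheme.IsRegular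
      (Literature.AlgebraicGeometry.Resolution.affineBlowup I)

/-- Statement of `stub_weakSectionLift` (OPEN, the hardest stub). [cite: HunekeSwanson2006, §8.5;
CossartPiltant2019, Rem. 3.2] -/
def WeakSectionLift : Prop :=
  ∀ (p : ℕ), p.Prime → ∀ d : ℕ, OneShot p d →
    ∀ (K : Type) [Field K] [CharP K p] (A : Type) [CommRing A] [IsDomain A] [Algebra K A]
      [Algebra.FiniteType K A], ringKrullDim A < ((d + 1 : ℕ) : WithBot ℕ∞) →
      ∃ I : Ideal A, I ≠ ⊥ ∧
        (∀ y : Literature.AlgebraicGeometry.Resolution.affineBlowup I,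
          IsIntegrallyClosed ((Literature.AlgebraicGeometry.Resolution.affineBlowup I).presheaf.stalk y)) ∧
        ∀ y : Literature.AlgebraicGeometry.Resolution.affineBlowup I,
          IsClosed ({y} : Set (Literature.AlgebraicGeometry.Resolution.affineBlowup I)) →
            HasSectionCertificate K A I y

/-- Statement of `stub_supportSharpening`. [cite: Hartshorne1977, II.7.17 and Ex. II.7.11(c);
CossartPiltant2019, Thm. 1.1 (i)(ii); Liu2002, Thm. 8.1.24] -/
def SupportSharpening : Prop :=
  ∀ (p : ℕ), p.Prime → ∀ (K : Type) [Field K] [CharP K p] (A : Type) [CommRing A] [IsDomain A]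
    [Algebra K A] [Algebra.FiniteType K A] (I : Ideal A), I ≠ ⊥ →
    Literature.AlgebraicGeometry.Resolution.Scheme.IsRegular
      (Literature.AlgebraicGeometry.Resolution.affineBlowup I) →
    ∃ I' : Ideal A, I' ≠ ⊥ ∧
      Literature.AlgebraicGeometry.Resolution.Scheme.IsRegular
        (Literature.AlgebraicGeometry.Resolution.affineBlowup I') ∧
      ∀ 𝔭 : PrimeSpectrum A, I' ≤ 𝔭.asIdeal ↔ ¬ IsRegularLocalRing (Localization.AtPrime 𝔭.asIdeal)

/-! ## The stubs

Lead reshape (2026-08-17, cycle 1): the size-L criterion `stub_closedPointCriterion` of the birth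
skeleton is cut into its three print-sized steps, each a registered stub —
`stub_closedPointsSuffice` (J-2: closed points suffice), `stub_lowDimPoint` (R₁: points of
dimension `≤ 1` on a normal blowing up) and `stub_certificateRegular` (the heart: Cartier ascent at a
certified closed point of dimension `≥ 2`) — and the criterion itself becomes the sorry-free
composition `closedPointCriterion_of_stubs` below. The two open stubs are untouched. -/

/-- STUB `stub_closedPointsSuffice` (PROVABLE, size M). **Closed points suffice for regularity of a
blowing up.** For an algebra `A` of finite type over a field `K` and any ideal `I`, if the local
ring of `Bl_I(Spec A)` at every CLOSED point is regular then `Bl_I(Spec A)` is regular. Proof route: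
`Bl_I(Spec A) → Spec A → Spec K` is locally of finite type (the blowing up of a Noetherian affine
scheme is proper), so the regular locus is open (tree
`isOpen_regularLocus_of_locallyOfFiniteType_field`, Matsumura Cor. to Thm. 30.5); its complement is
a closed subset of a quasi-compact (`CompactSpace`) T₀ space, hence empty or containing a closed
point (Mathlib `IsClosed.exists_closed_singleton`). [cite: Matsumura1987, §30, Cor. to Thm. 30.5] -/
theorem stub_closedPointsSuffice (K : Type) [Field K] (A : Type) [CommRing A] [Algebra K A]
    [Algebra.FiniteType K A] (I : Ideal A)
    (h : ∀ y : Literature.AlgebraicGeometry.Resolution.affineBlowup I,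
      IsClosed ({y} : Set (Literature.AlgebraicGeometry.Resolution.affineBlowup I)) →
        IsRegularLocalRing ((Literature.AlgebraicGeometry.Resolution.affineBlowup I).presheaf.stalk y)) :
    Literature.AlgebraicGeometry.Resolution.Scheme.IsRegular
      (Literature.AlgebraicGeometry.Resolution.affineBlowup I) :=
  -- LANDED (wave 1, p147124): Theorems/SectionAscentFibrewiseClosedPointsClosedPointsSuffice.lean
  Summit.ResolutionOfSingularities.ResolutionOfSingularities.Theorems.SectionAscent.ClosedPointsSuffice.stub_closedPointsSuffice
    K A I h

/-- STUB `stub_lowDimPoint` (PROVABLE, size M). **R₁ for a normal blowing up.** For a Noetherian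
domain `A`, `I ≠ 0`, and a point `y` of `Bl_I(Spec A)` whose local ring is integrally closed and of
Krull dimension `≤ 1`, the local ring at `y` is regular: it is a Noetherian local domain
(`Bl_I(Spec A)` is integral, tree `affineBlowup.isIntegral`; stalks are localizations of the
Noetherian chart rings `(A[It])_{(at)}`), so it is a field in dimension `0` and a discrete valuation
ring in dimension `1` (integrally closed Noetherian local domain of dimension one, Mathlib
`IsDiscreteValuationRing.TFAE`), both regular. [cite: Matsumura1987, Thm. 11.2 and Thm. 23.8 (R₁)] -/
theorem stub_lowDimPoint (A : Type) [CommRing A] [IsDomain A] [IsNoetherianRing A]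
    (I : Ideal A) (hI : I ≠ ⊥) (y : Literature.AlgebraicGeometry.Resolution.affineBlowup I)
    (hnorm : IsIntegrallyClosed ((Literature.AlgebraicGeometry.Resolution.affineBlowup I).presheaf.stalk y))
    (hdim : ringKrullDim ((Literature.AlgebraicGeometry.Resolution.affineBlowup I).presheaf.stalk y) ≤ 1) :
    IsRegularLocalRing ((Literature.AlgebraicGeometry.Resolution.affineBlowup I).presheaf.stalk y) :=
  -- LANDED (wave 1, p148953): Theorems/SectionAscentFibrewiseClosedPointsLowDimPoint.lean
  Summit.ResolutionOfSingularities.ResolutionOfSingularities.Theorems.SectionAscent.LowDimPoint.stub_lowDimPoint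
    A I hI y hnorm hdim

/-- STUB `stub_certificateRegular` (PROVABLE, size L — the heart of the criterion). **Cartier
ascent at a certified closed point.** `A` an integral algebra of finite type over a field `K`,
`I ≠ 0`, `Bl_I(Spec A)` normal (all stalks integrally closed), `y` a CLOSED point with
`dim 𝒪_y > 1` carrying a section certificate, given as explicit data (the fields of
`HasSectionCertificate`, so that the stub is stated in tree vocabulary only): `m ≥ 1`,
`g_j ∈ I^m` all vanishing at `y` (ha), `y` isolated among its generizations in their base locus
(hb), and `Bl_I` of the generic member `H_g = Spec((K(t) ⊗_K A)/(Σ t_j ⊗ g_j))` regular (hc, the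
body of `GenericSectionBlowupRegular`). Then `𝒪_y` is regular. Proof route: with
`R = 𝒪_y` and `R(t) = R[t_1..t_s]_{𝔪_R R[t]}` (Nagata; `κ(y)/K` finite as `y` is closed, so `R(t)`
is the local ring of `Bl_I ⊗_K K(t) = Bl_{I(K(t) ⊗ A)}` at the unique point `P` above `y`): on a
chart `D₊(at) ∋ y` put `c_j = g_j/a^m ∈ 𝔪_R`, `ℓ' = Σ t_j c_j ∈ 𝔪_{R(t)}`, `ℓ' ≠ 0` by (b) at the
generic point; `R(t)/(ℓ')` is the local ring of the strict transform `Bl_{I𝒪_{H_g}}(H_g)` at the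
point above `P` — the `a`-power torsion of `R(t)/(ℓ')` vanishes because its associated primes are
minimal (normal ⇒ S₂ ⇒ principal ideals unmixed, and `R(t)` is normal with `R`) and a minimal prime
containing `a` would be `q_z R(t)` for a proper generization `z ⤳ y` with all `c_j ∈ q_z`, excluded
by (b) — hence regular by (c) (Stacks 080E); so `R(t)` is regular (EGA IV 0.17.1.7, tree
`IsRegularLocalRing.of_quotient_span_singleton`) and `R` is regular by faithfully flat descent
along `R → R(t)` (Matsumura 23.7, tree `RegularLocalRingsFlatDescent`).
[cite: EGAIV4, 0.17.1.7; Matsumura1987, Thm. 23.7 and Thm. 23.8; StacksProject, Tag 080E;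
HunekeSwanson2006, Lemma 8.4.2] -/
theorem stub_certificateRegular (K : Type) [Field K] (A : Type) [CommRing A] [IsDomain A]
    [Algebra K A] [Algebra.FiniteType K A] (I : Ideal A) (hI : I ≠ ⊥)
    (hnorm : ∀ y : Literature.AlgebraicGeometry.Resolution.affineBlowup I,
      IsIntegrallyClosed ((Literature.AlgebraicGeometry.Resolution.affineBlowup I).presheaf.stalk y))
    (y : Literature.AlgebraicGeometry.Resolution.affineBlowup I)
    (hy : IsClosed ({y} : Set (Literature.AlgebraicGeometry.Resolution.affineBlowup I)))
    (hdim : 1 < ringKrullDim ((Literature.AlgebraicGeometry.Resolution.affineBlowup I).presheaf.stalk y))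
    (m s : ℕ) (g : Fin s → A) (hg : ∀ j, g j ∈ I ^ m) (hm : 0 < m)
    (ha : ∀ j, (⟨Polynomial.monomial m (g j), reesAlgebra.monomial_mem.mpr (hg j)⟩ : reesAlgebra I) ∈
      y.asHomogeneousIdeal)
    (hb : ∀ z : Literature.AlgebraicGeometry.Resolution.affineBlowup I, z ⤳ y → z ≠ y →
      ∃ j, (⟨Polynomial.monomial m (g j), reesAlgebra.monomial_mem.mpr (hg j)⟩ : reesAlgebra I) ∉
        z.asHomogeneousIdeal)
    (hc : let Ks := FractionRing (MvPolynomial (Fin s) K)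
      let ℓ : TensorProduct K Ks A :=
        ∑ j : Fin s, (algebraMap (MvPolynomial (Fin s) K) Ks (MvPolynomial.X j)) ⊗ₜ[K] g j
      let φ : A →+* (TensorProduct K Ks A ⧸ Ideal.span {ℓ}) :=
        (Ideal.Quotient.mk (Ideal.span {ℓ})).comp
          (Algebra.TensorProduct.includeRight (R := K) (A := Ks) (B := A)).toRingHom
      Literature.AlgebraicGeometry.Resolution.Scheme.IsRegular
        (Literature.AlgebraicGeometry.Resolution.affineBlowup (I.map φ))) :
    IsRegularLocalRing ((Literature.AlgebraicGeometry.Resolution.affineBlowup I).presheaf.stalk y) :=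
  -- LANDED (wave 1, p155011 + helpers p149281 p149282 p149283 p152380):
  -- Theorems/SectionAscentFibrewiseClosedPointsCertificateRegular{,BaseChange,LocQuot,StrictTransform,Chart}.lean
  Summit.ResolutionOfSingularities.ResolutionOfSingularities.Theorems.SectionAscent.CertificateRegular.stub_certificateRegular
    K A I hI hnorm y hy hdim m s g hg hm ha hb hc

/-- **The closed-point section criterion from its three registered pieces** (sorry-free
composition; formerly the single stub `stub_closedPointCriterion`): closed points suffice
(`stub_closedPointsSuffice`); at a closed point of dimension `≤ 1` normality gives regularity
(`stub_lowDimPoint`); at a closed point of dimension `> 1` the certificate does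
(`stub_certificateRegular`). [cite: EGAIV4, 0.17.1.7; Matsumura1987, Thm. 23.7 and 23.8] -/
theorem closedPointCriterion_of_stubs : ClosedPointCriterion := by
  intro p _hp K _ _ A _ _ _ _ I hI hnorm hcert
  haveI : IsNoetherianRing A := Algebra.FiniteType.isNoetherianRing K A
  refine stub_closedPointsSuffice K A I fun y hy => ?_
  by_cases hdim :
      ringKrullDim ((Literature.AlgebraicGeometry.Resolution.affineBlowup I).presheaf.stalk y) ≤ 1
  · exact stub_lowDimPoint A I hI y (hnorm y) hdim
  · obtain ⟨m, s, g, hg, hm, ha, hb, hc⟩ := hcert y hy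
    exact stub_certificateRegular K A I hI hnorm y hy (not_le.mp hdim) m s g hg hm ha hb hc

/-- STUB `stub_weakSectionLift` (OPEN — the hardest stub; the route's `SimultaneousLift`, typed
at closed points). **Weak simultaneous section lift.** If `OneShot p d` holds (strong one-shot
resolution of integral affine varieties of dimension `< d` over every field of characteristic
`p`), then every integral affine `Spec A` of finite type over a field `K` of characteristic `p`
with `dim A < d + 1` has an ideal `I ≠ 0` with `Bl_I(Spec A)` normal such that every closed point
`y` of `Bl_I` carries a section certificate: a sub-system `g ⊆ I^m` through `y`, with `y` isolated
among its generizations in the base locus, whose generic member — a `K(t)`-scheme of dimension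
`< d`, to whose components `OneShot p d` applies over `K(t)` — has regular blowing up along `I`.
Implied by weak one-shot resolution at level `d + 1` (certificate = generators of `(𝔭_y)_m`,
`m ≫ 0`, when `Bl_I` is regular); asks nothing about exact support. Why it might fail: the
resolving ideals of the generic sections live over `K(t)` and may have no common `t`-constant lift;
a closed singular point recurring on every candidate model (vertical kangaroo).
[cite: HunekeSwanson2006, Def. 8.4.1, Lemma 8.4.2 and §8.5; CossartPiltant2019, Rem. 3.2;
HauserPerlega2019] -/
theorem stub_weakSectionLift (p : ℕ) (hp : p.Prime) (d : ℕ) (hd : OneShot p d)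
    (K : Type) [Field K] [CharP K p] (A : Type) [CommRing A] [IsDomain A] [Algebra K A]
    [Algebra.FiniteType K A] (hdim : ringKrullDim A < ((d + 1 : ℕ) : WithBot ℕ∞)) :
    ∃ I : Ideal A, I ≠ ⊥ ∧
      (∀ y : Literature.AlgebraicGeometry.Resolution.affineBlowup I,
        IsIntegrallyClosed ((Literature.AlgebraicGeometry.Resolution.affineBlowup I).presheaf.stalk y)) ∧
      ∀ y : Literature.AlgebraicGeometry.Resolution.affineBlowup I,
        IsClosed ({y} : Set (Literature.AlgebraicGeometry.Resolution.affineBlowup I)) →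
          HasSectionCertificate K A I y := by
  sorry

/-- STUB `stub_supportSharpening` (OPEN in dimension `≥ 4`, known in dimension `≤ 3` and in
characteristic `0`; size L/open). **Strong from weak one-shot resolution.** An integral affine
variety `Spec A` of finite type over a field of characteristic `p` that admits a nonzero ideal `I`
with `Bl_I(Spec A)` regular admits an ideal `I' ≠ 0` with `Bl_{I'}(Spec A)` regular and
`V(I') = Sing(Spec A)` exactly (`I' ≤ 𝔭 ↔ A_𝔭` not regular), i.e. a one-shot resolution that is an
isomorphism over the regular locus. Implied by strong projective resolution of `Spec A`
(`X̃ = Bl_{I'}` with `I'` cosupported off `Reg`); the isolated cost of the STRENGTHEN lens. Why it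
might fail: undoing the modification of regular points of `V(I)` while staying proper over `Sing`
is a patching problem with no known mechanism in dimension `≥ 4`.
[cite: Hartshorne1977, Thm. II.7.17 and Ex. II.7.11(c); CossartPiltant2019, Thm. 1.1 (i)(ii);
Liu2002, Thm. 8.1.24] -/
theorem stub_supportSharpening (p : ℕ) (hp : p.Prime) (K : Type) [Field K] [CharP K p]
    (A : Type) [CommRing A] [IsDomain A] [Algebra K A] [Algebra.FiniteType K A]
    (I : Ideal A) (hI : I ≠ ⊥)
    (hreg : Literature.AlgebraicGeometry.Resolution.Scheme.IsRegular
      (Literature.AlgebraicGeometry.Resolution.affineBlowup I)) :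
    ∃ I' : Ideal A, I' ≠ ⊥ ∧
      Literature.AlgebraicGeometry.Resolution.Scheme.IsRegular
        (Literature.AlgebraicGeometry.Resolution.affineBlowup I') ∧
      ∀ 𝔭 : PrimeSpectrum A, I' ≤ 𝔭.asIdeal ↔ ¬ IsRegularLocalRing (Localization.AtPrime 𝔭.asIdeal) := by
  sorry


/-! ## Calibration of the open stubs (lead, wave 2): what exactly remains

Three further registered stubs, landed `--supports` in wave 2, pin down the logical position of
the two open stubs. (They are not in the cone of `FibrewiseClosedPoints_of`; they calibrate it.)

* `WeakOneShot p d` — WEAK one-shot affine resolution below dimension `d` (some `I ≠ 0` with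
  `Bl_I(Spec A)` regular, no condition on `V(I)`).
* `hasSectionCertificate_of_isRegular` (stub `stub_certificatesOnRegularBlowup`, p159562): on a
  REGULAR blowing up every closed point carries a section certificate — the converse of the
  criterion. Hence `weakLift_iff_weakOneShot` / `weakSectionLift_iff`: the open stub
  `stub_weakSectionLift` is, literally, the implication `OneShot p d → WeakOneShot p (d+1)`
  ("strong one-shot below `d` ⇒ weak one-shot below `d+1`"), and `stub_supportSharpening` is
  `WeakOneShot`-witness ⇒ `OneShot`-witness (exact support). Neither is weaker or stronger than
  that; both are open in print (`supportSharpening` already for threefolds: CossartPiltant2019,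
  p. 3: "it is not even known if such π can be obtained by blowing up an ideal sheaf whose zero
  locus is Sing 𝒳, even when 𝒳 is affine").
* `oneShot_one`, `oneShot_two` (stubs `stub_oneShotDimZero` p156410, `stub_oneShotCurves`
  p157426: fields, and curves by blowing up the conductor): the crux holds at `d = 0` and `d = 1`
  (`fibrewiseClosedPoints_inst_zero/one`), unconditionally. -/

/-- `WeakOneShot p d` — WEAK one-shot affine resolution below dimension `d` in characteristic `p`:
every integral affine `Spec A` of finite type over a field `K` of characteristic `p` with
`dim A < d` has an ideal `I ≠ 0` with `Bl_I(Spec A)` regular (nothing asked of `V(I)`).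
[cite: CossartPiltant2019, Thm. 1.1 (i) (dim ≤ 3, projective over affines)] -/
def WeakOneShot (p d : ℕ) : Prop :=
  ∀ (K : Type) [Field K] [CharP K p] (A : Type) [CommRing A] [IsDomain A] [Algebra K A]
    [Algebra.FiniteType K A], ringKrullDim A < (d : WithBot ℕ∞) → ∃ I : Ideal A, I ≠ ⊥ ∧
      Literature.AlgebraicGeometry.Resolution.Scheme.IsRegular
        (Literature.AlgebraicGeometry.Resolution.affineBlowup I)

/-- Strong one-shot resolution is in particular weak one-shot resolution. [folklore] -/
theorem weakOneShot_of_oneShot {p d : ℕ} (h : OneShot p d) : WeakOneShot p d := by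
  intro K _ _ A _ _ _ _ hdim
  obtain ⟨I, hI, hreg, -⟩ := h K A hdim
  exact ⟨I, hI, hreg⟩

/-- **Regular blowing ups carry certificates** (registered calibration stub
`stub_certificatesOnRegularBlowup`, landed p159562): if `Bl_I(Spec A)` is regular (`A` an integral
algebra of finite type over a field `K`, `I ≠ 0`) then every closed point has a section
certificate — base locus `{y}` from the maximal ideal `q_y` of the charts, regularity of the
generic member's blowing up by `Σ t_j c̄_j ≠ 0` in `(𝔪/𝔪²)(t)`. [folklore] -/
theorem hasSectionCertificate_of_isRegular (K : Type) [Field K] (A : Type) [CommRing A]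
    [IsDomain A] [Algebra K A] [Algebra.FiniteType K A] (I : Ideal A) (hI : I ≠ ⊥)
    (hreg : Literature.AlgebraicGeometry.Resolution.Scheme.IsRegular
      (Literature.AlgebraicGeometry.Resolution.affineBlowup I))
    (y : Literature.AlgebraicGeometry.Resolution.affineBlowup I)
    (hy : IsClosed ({y} : Set (Literature.AlgebraicGeometry.Resolution.affineBlowup I))) :
    HasSectionCertificate K A I y :=
  Summit.ResolutionOfSingularities.ResolutionOfSingularities.Theorems.SectionAscent.CertificatesOnRegularBlowup.stub_certificatesOnRegularBlowup
    K A I hI hreg y hy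

/-- **Calibration of `stub_weakSectionLift`**: for fixed `p` (prime) and `d`, the CONCLUSION of the
weak simultaneous section lift below dimension `d` — a normal blowing up with certificates at all
closed points — holds for every integral affine `Spec A` iff WEAK one-shot resolution holds below
dimension `d`: (⇒) by the landed closed-point criterion; (⇐) a regular blowing up is normal
(tree `isIntegrallyClosed_of_isRegularLocalRing`) and carries certificates
(`hasSectionCertificate_of_isRegular`). [folklore] -/
theorem weakLift_iff_weakOneShot (p : ℕ) (hp : p.Prime) (d : ℕ) :
    (∀ (K : Type) [Field K] [CharP K p] (A : Type) [CommRing A] [IsDomain A] [Algebra K A]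
      [Algebra.FiniteType K A], ringKrullDim A < (d : WithBot ℕ∞) →
      ∃ I : Ideal A, I ≠ ⊥ ∧
        (∀ y : Literature.AlgebraicGeometry.Resolution.affineBlowup I,
          IsIntegrallyClosed ((Literature.AlgebraicGeometry.Resolution.affineBlowup I).presheaf.stalk y)) ∧
        ∀ y : Literature.AlgebraicGeometry.Resolution.affineBlowup I,
          IsClosed ({y} : Set (Literature.AlgebraicGeometry.Resolution.affineBlowup I)) →
            HasSectionCertificate K A I y) ↔
    WeakOneShot p d := by
  constructor
  · intro h K _ _ A _ _ _ _ hdim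
    obtain ⟨I, hI, hnorm, hcert⟩ := h K A hdim
    exact ⟨I, hI, closedPointCriterion_of_stubs p hp K A I hI hnorm hcert⟩
  · intro h K _ _ A _ _ _ _ hdim
    obtain ⟨I, hI, hreg⟩ := h K A hdim
    refine ⟨I, hI, fun y => ?_, fun y hy => hasSectionCertificate_of_isRegular K A I hI hreg y hy⟩
    haveI : IsRegularLocalRing ((Literature.AlgebraicGeometry.Resolution.affineBlowup I).presheaf.stalk y) :=
      hreg y
    exact Literature.AlgebraicGeometry.Resolution.isIntegrallyClosed_of_isRegularLocalRing _

/-- **What the open stub `stub_weakSectionLift` IS**: the statement `WeakSectionLift` is equivalent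
to "strong one-shot resolution below `d` implies weak one-shot resolution below `d + 1`, for every
prime `p` and every `d`" — the weak form of the inductive step, open from `d + 1 = 4` onward in
every characteristic. [folklore] -/
theorem weakSectionLift_iff :
    WeakSectionLift ↔ ∀ p : ℕ, p.Prime → ∀ d : ℕ, OneShot p d → WeakOneShot p (d + 1) := by
  constructor
  · intro h p hp d hd
    exact (weakLift_iff_weakOneShot p hp (d + 1)).mp (fun K _ _ A _ _ _ _ hdim => h p hp d hd K A hdim)
  · intro h p hp d hd K _ _ A _ _ _ _ hdim
    exact (weakLift_iff_weakOneShot p hp (d + 1)).mpr (h p hp d hd) K A hdim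

/-- **What the open stub `stub_supportSharpening` gives**: with it, weak one-shot resolution is
strong one-shot resolution (exact support), dimension by dimension. [folklore] -/
theorem oneShot_of_weakOneShot (hS : SupportSharpening) {p : ℕ} (hp : p.Prime) {d : ℕ}
    (h : WeakOneShot p d) : OneShot p d := by
  intro K _ _ A _ _ _ _ hdim
  obtain ⟨I, hI, hreg⟩ := h K A hdim
  exact hS p hp K A I hI hreg

/-- **`OneShot p 1`** (registered instance stub `stub_oneShotDimZero`, landed p156410): an integral
affine variety of dimension `0` over a field is a field; `I = ⊤` works. [folklore] -/
theorem oneShot_one (p : ℕ) (hp : p.Prime) : OneShot p 1 :=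
  fun K _ _ A _ _ _ _ hdim =>
    Summit.ResolutionOfSingularities.ResolutionOfSingularities.Theorems.SectionAscent.OneShotDimZero.stub_oneShotDimZero
      p hp K A hdim

/-- **`OneShot p 2` — strong one-shot resolution of affine curves over any field** (registered
instance stub `stub_oneShotCurves`, landed p157426): blowing up the conductor `𝔣` of the
normalisation `Ã/A` gives `Bl_𝔣(Spec A) = Spec`-locally the Dedekind domain `Ã`
(`A[𝔣/a] ⊇ Ã`), and `V(𝔣)` is exactly the non-regular (= non-normal) locus.
[cite: Liu2002, Prop. 4.1.27 and Cor. 4.1.30] -/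
theorem oneShot_two (p : ℕ) (hp : p.Prime) : OneShot p 2 :=
  fun K _ _ A _ _ _ _ hdim =>
    Summit.ResolutionOfSingularities.ResolutionOfSingularities.Theorems.SectionAscent.OneShotCurves.stub_oneShotCurves
      p hp K A hdim

/-- The crux instance `d = 0`, unconditionally: `OneShot p 0 → Almost p 1 → OneShot p 1`.
[folklore] -/
theorem fibrewiseClosedPoints_inst_zero (p : ℕ) (hp : p.Prime) :
    OneShot p 0 → Almost p 1 → OneShot p 1 :=
  fun _ _ => oneShot_one p hp

/-- The crux instance `d = 1`, unconditionally (curves): `OneShot p 1 → Almost p 2 → OneShot p 2`.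
[folklore] -/
theorem fibrewiseClosedPoints_inst_one (p : ℕ) (hp : p.Prime) :
    OneShot p 1 → Almost p 2 → OneShot p 2 :=
  fun _ _ => oneShot_two p hp

/-- Hence the inductive step of the crux holds for all `d ≤ 1` in every characteristic. [folklore] -/
theorem fibrewiseClosedPoints_of_le_one (p : ℕ) (hp : p.Prime) (d : ℕ) (hd : d ≤ 1) :
    OneShot p d → Almost p (d + 1) → OneShot p (d + 1) := by
  interval_cases d
  · exact fibrewiseClosedPoints_inst_zero p hp
  · exact fibrewiseClosedPoints_inst_one p hp

/-! ## The composition: the crux from the three stub STATEMENTS (sorry-free closure) -/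

/-- **The inductive step of strong affine one-shot resolution from the three stub statements**
(no `sorry` in its closure): lift (normal `Bl_I` with certificates at closed points) ⇒ criterion
(`Bl_I` regular) ⇒ sharpening (`I'` with `Bl_{I'}` regular and `V(I') = Sing` exactly).
[folklore] -/
theorem step_of_parts (hC : ClosedPointCriterion) (hL : WeakSectionLift) (hS : SupportSharpening) :
    ∀ p : ℕ, p.Prime → ∀ d : ℕ, OneShot p d → OneShot p (d + 1) := by
  intro p hp d hOne K _ _ A _ _ _ _ hdim
  -- the weak simultaneous section lift: a normal blowing up with certificates at closed points
  obtain ⟨I, hI0, hnorm, hcert⟩ := hL p hp d hOne K A hdim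
  -- the closed-point section criterion: that blowing up is regular
  have hreg : Literature.AlgebraicGeometry.Resolution.Scheme.IsRegular
      (Literature.AlgebraicGeometry.Resolution.affineBlowup I) :=
    hC p hp K A I hI0 hnorm hcert
  -- support sharpening: trade `I` for `I'` with exact support, keeping regularity
  obtain ⟨I', hI'0, hreg', hexact⟩ := hS p hp K A I hI0 hreg
  exact ⟨I', hI'0, hreg', hexact⟩

set_option linter.defProp false in
/-- **`FibrewiseClosedPoints` from the three stub statements** — the reduction itself,
kernel-checked with NO `sorry` in its closure: unfold the route's `let`s
(`fibrewiseClosedPoints_iff`), discard the idle hypothesis `Almost p (d+1)` (inhabited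
unconditionally, refuter evidence on this item) and apply `step_of_parts`. (A `def`, not a
`theorem`, only so that the skeleton audit's unique crux-concluding theorem is
`FibrewiseClosedPoints_of` below; its type is the implication "stub statements ⇒ crux".)
[folklore] -/
def FibrewiseClosedPoints_of_parts (hC : ClosedPointCriterion) (hL : WeakSectionLift)
    (hS : SupportSharpening) : FibrewiseClosedPoints := by
  rw [fibrewiseClosedPoints_iff]
  intro p hp d hOne _hAlmost
  exact step_of_parts hC hL hS p hp d hOne

/-- **The crux `FibrewiseClosedPoints`, assembled from the registered stubs** (the skeleton
theorem: concludes the route decl BY NAME; its proof is `FibrewiseClosedPoints_of_parts` applied to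
`closedPointCriterion_of_stubs` and the two open stubs; the only `sorry`s in its closure are the
five `stub_*`: `stub_closedPointsSuffice`, `stub_lowDimPoint`, `stub_certificateRegular`,
`stub_weakSectionLift`, `stub_supportSharpening`). -/
theorem FibrewiseClosedPoints_of : FibrewiseClosedPoints :=
  FibrewiseClosedPoints_of_parts
    closedPointCriterion_of_stubs
    (fun p hp d hd K _ _ A _ _ _ _ hdim => stub_weakSectionLift p hp d hd K A hdim)
    (fun p hp K _ _ A _ _ _ _ I hI hreg => stub_supportSharpening p hp K A I hI hreg)

end Summit.ResolutionOfSingularities.ResolutionOfSingularities.Cruxes.FibrewiseClosedPoints.Lines.Birth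

end
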